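import Summits.BirchSwinnertonDyer.BirchSwinnertonDyer.Theorems.KolyvaginRoadThreeMethod2LevelSystems
import Summits.BirchSwinnertonDyer.BirchSwinnertonDyer.Theorems.KolyvaginRoadThreeMethod2LocalFrobenius
import Literature.NumberTheory.GaloisRepresentations.IntegralGaloisActionProofs
import HarnessLib

/-!
# KOLY method line, crux stmt-BirchSwinnertonDyer-19574 `ZhangSharpFrameAtThreeHL`: a STRICT class is TRANSVERSE
# (`torsionLocalKer ≤ Method2.transverseLocalKer`) (cell `bsd-stepL`, seat `bsd-stepL-zhang3-p1` g8; `--supports 19574`,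
# helper; discharges the hypothesis `htr0` of `Method2.mem_transverseLocalKer_iff_localization_mem_map`, item 2 of the
# S2-ENGINE work package of the v3 re-line, memo `HOME/zhang3/S2-RELINE-19574.md`)

If the localisation of `x ∈ H¹(K, E[3])` at the finite place `v` vanishes, then the cocycle of `x` vanishes on
`D_𝔓 ∩ Gal(K̄/K(E[3]))` for EVERY prime `𝔓 ∣ v` of `ℤ̄_K` — in particular on `D_𝔓 ∩ Gal(K̄/K[ℓ]) ∩ Gal(K̄/K(E[3]))`,
i.e. `x ∈ transverseLocalKer W K ι ℓ v` for every `ℓ`, `ι`. Proof: for the prime `𝔓₀` cut out by the chosen embedding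
`K̄ → K̄_v`, the cocycle is a coboundary `d ↦ dP − P` on `D_{𝔓₀}` (zhang3-p1 g7
`LocalFrob.oneCocycleClass_mem_torsionLocalKer_iff`), which vanishes where `E[3]` is fixed; any other `𝔓 = σ𝔓₀`
(transitivity, tree THEOREM `exists_smul_eq_of_mem_primesAbove_holds`) has `D_𝔓 = σ D_{𝔓₀} σ⁻¹`, and
`[x, σ d₀ σ⁻¹] = σ [x, d₀]` (`h1Eval_conj`). 0 definitions, 0 facts, 0 `sorry`; closes nothing (T7).

References: [cite: WZhang2014, §8.1 (H¹_tr ⊃ 0)] [cite: NeukirchANT1999, Ch. I §9 Prop. (9.1), Ch. II §9 (9.6)]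
[cite: GrossLMS1991, Prop. 9.6].
-/

noncomputable section

open scoped Classical Pointwise

namespace Summit.BirchSwinnertonDyer.Rank1Residual.X11b.Three.Koly.Method2

open WeierstrassCurve NumberField IsDedekindDomain Field
  Literature.NumberTheory.EllipticCurves Literature.NumberTheory.EllipticCurves.ModularForms
  Literature.NumberTheory.GaloisRepresentations Module

variable (W : WeierstrassCurve ℚ) (K : Type) [Field K] [NumberField K] [W.IsElliptic]

/-- **A class with ZERO localisation at `v` is transverse at `v`** (for every `ℓ` and every complex embedding `ι`):
`torsionLocalKer_v ≤ transverseLocalKer ι ℓ v`. [cite: WZhang2014, §8.1] [cite: NeukirchANT1999, Ch. I §9 (9.1)] -/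
theorem torsionLocalKer_le_transverseLocalKer (ι : K →+* ℂ) (ℓ : ℕ) (v : HeightOneSpectrum (𝓞 K)) :
    (W.baseChange K).torsionLocalKer (v.adicCompletion K) ((3 ^ 1 : ℕ) : ℤ) ≤ transverseLocalKer W K ι ℓ v := by
  intro x hx 𝔓 h𝔓 d hdD _ hdT
  obtain ⟨𝔐, h𝔐⟩ := v.localPrimesAbove_nonempty
  have h𝔓₀ : v.primeBelow (closureEmb (K := K) (v.adicCompletion K)) 𝔐 ∈ v.primesAbove :=
    HeightOneSpectrum.primeBelow_mem_primesAbove h𝔐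
  -- the cocycle of `x` is a coboundary on `D_{𝔓₀}`
  have hx' : oneCocycleClass _ (reprCocycle (W.baseChange K) ((3 ^ 1 : ℕ) : ℤ) x) ∈
      (W.baseChange K).torsionLocalKer (v.adicCompletion K) ((3 ^ 1 : ℕ) : ℤ) := by
    rw [oneCocycleClass_reprCocycle]; exact hx
  obtain ⟨P, hP⟩ := (LocalFrob.oneCocycleClass_mem_torsionLocalKer_iff (W.baseChange K) (n := 3 ^ 1)
    (by norm_num) h𝔐 (reprCocycle (W.baseChange K) ((3 ^ 1 : ℕ) : ℤ) x)).mp hx'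
  -- transitivity: `σ • 𝔓₀ = 𝔓`, so `d = σ d₀ σ⁻¹` with `d₀ ∈ D_{𝔓₀}`
  obtain ⟨σ, hσ⟩ := HeightOneSpectrum.exists_smul_eq_of_mem_primesAbove_holds h𝔓₀ h𝔓
  have hd' : d ∈ MulAut.conj σ •
      (v.primeBelow (closureEmb (K := K) (v.adicCompletion K)) 𝔐).decompositionSubgroup (absoluteGaloisGroup K) := by
    rw [← Ideal.decompositionSubgroup_smul, hσ]; exact hdD
  obtain ⟨d₀, hd₀, rfl⟩ := (Subgroup.mem_smul_pointwise_iff_exists _ _ _).mp hd'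
  have hconj : (MulAut.conj σ • d₀ : absoluteGaloisGroup K) = σ * d₀ * σ⁻¹ := rfl
  -- `d₀` fixes `E[3]` (the fixing subgroup is normal)
  have hd₀T : d₀ ∈ torsionFixing (W.baseChange K) ((3 ^ 1 : ℕ) : ℤ) := by
    have h := (torsionFixing_normal (W.baseChange K) ((3 ^ 1 : ℕ) : ℤ)).conj_mem _ hdT σ⁻¹
    rw [hconj, inv_inv] at h
    simpa [mul_assoc] using h
  rw [hconj, h1Eval_conj (W.baseChange K) _ x σ hd₀T]
  -- `[x, d₀] = d₀ P − P = 0`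
  have h0 : h1Eval (W.baseChange K) ((3 ^ 1 : ℕ) : ℤ) x d₀ = 0 := by
    change (reprCocycle (W.baseChange K) ((3 ^ 1 : ℕ) : ℤ) x).1 d₀ = 0
    rw [hP d₀ hd₀, smul_eq_of_mem_torsionFixing (W.baseChange K) _ hd₀T, sub_self]
  rw [h0, smul_zero]

end Summit.BirchSwinnertonDyer.Rank1Residual.X11b.Three.Koly.Method2

end
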